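import Summits.Langlands.Langlands.Theorems.NonParallelVoidTwistedInductionParallelSymmetriseDefs
import Summits.Langlands.Langlands.Theorems.NonParallelVoidTwistedInductionParallelSymmetriseDefsV7
import Summits.Langlands.Langlands.Theorems.NonParallelVoidTwistedInductionParallelStubPdAtSplitPrime
import Summits.Langlands.Langlands.Theorems.NonParallelVoidTwistedInductionParallelStubPotentialAutomorphyOfInducedTwistIrr
import Summits.Langlands.Langlands.Theorems.NonParallelVoidTwistedInductionParallelStubAutomorphicTwistOfInducedAutomorphy
import Summits.Langlands.Langlands.Theorems.NonParallelVoidTwistedInductionParallelStubParallelOfAutomorphicTwist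
import Literature.NumberTheory.Automorphic.BLGGT2014PotentialAutomorphy
import Literature.NumberTheory.Automorphic.BLGGT2014PotentialAutomorphyAvoid
import Literature.NumberTheory.Automorphic.AutomorphicInductionOfSelfTwist
import Literature.NumberTheory.Automorphic.HenniartAutomorphicInduction
import Literature.NumberTheory.GaloisRepresentations.PotentialDiagonalizabilityGaoLiu
import Literature.NumberTheory.GaloisRepresentations.PadicAlgebraDegreeOnePlace
import Literature.NumberTheory.Automorphic.AHTW2026ExactWeights
import Literature.NumberTheory.PAdicHodge.FontainePstLabelledWeightsSchemata
import Literature.NumberTheory.PAdicHodge.FontainePstLabelledWeightsDetSchema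
import Literature.NumberTheory.PAdicHodge.FontainePstInductionSchemata
import Literature.NumberTheory.GaloisRepresentations.PotentialDiagonalizabilityPermanence
import Literature.NumberTheory.GaloisCohomology.PoitouTateSha
import Literature.NumberTheory.GaloisRepresentations.FrobeniusDensityTheorem
import Literature.NumberTheory.Automorphic.AdeleBaseChange
import Summits.Langlands.Langlands.Theorems.NonParallelVoidTwistedInductionParallelStubTwoDivisibleOfLocally

/-!
# Line `symmetrise-pd-split` — crux `TwistedInductionParallel` of route `NonParallelVoid`

Crux item `stmt-Langlands-17000`, decl
`Summit.Langlands.Langlands.Theses.NonParallelVoid.TwistedInductionParallel`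
(F imaginary quadratic, `p ≥ 11` split in `F`, `ρ : Γ_F → GL₂(ℚ̄_p)` irreducible, a.e. unramified,
crystalline at both `v ∣ p` with two distinct labelled Hodge–Tate weights at every label,
`ρ̄|Γ_(F(ζ_p))` absolutely irreducible, all gaps of the same parity ⟹ all gaps equal).

Strategist line (alternative to `Lines/birth.lean`).  Same lever as the route (twist, induce to a
totally real field, potential automorphy, Arthur–Clozel descent, Clozel purity), but cut along the
two places where the lever, as written in the route header, is NOT in print — and repaired at the
first of them:

* `stub_symmetrisingTwist` — **the determinant must be symmetrised over a REAL QUADRATIC base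
  change, not over `F`** (strategist finding, negation lens).  The header's twist `φ` over `F` with
  `det(ρ ⊗ φ)` `Gal(F/ℚ)`-invariant need not exist: the obstruction is the class of `det ρ` in
  `X_F / (res X_ℚ + 2 X_F) ≅ Hom(G_F^ab[2] ∩ ker N_{F/ℚ}, ±1)`, non-zero e.g. when `det ρ|I_v` is the
  quadratic character of `ℤ_ℓ^×` at ONE of the two places above a split `ℓ ≡ 3 (mod 4)` (the
  quadratic character of `ℤ_ℓ^×` is then not the square of a character).  Over `E = F·K`, `K` real
  quadratic with `[E_w : F_v]` even at every place where `det ρ` is locally odd, the obstruction dies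
  (`G_E^ab[2]` is generated by local `−1`'s for `E` totally imaginary — Grunwald–Wang for squares —
  and `det ρ ∘ N_{E/F}` kills them by the parity choice); a second class-field-theoretic adjustment
  makes the descended determinant `θ` on `K` TOTALLY ODD (parallel signature is not automatic), and a
  generic finite part of `χ` keeps `Ind_E^K(ρ̄|_E ⊗ χ̄)|K(ζ_p)` absolutely irreducible.  Output:
  `SymmetrisingTwistDatum F p ρ`.
* `stub_pdAtSplitPrime` — **potential diagonalisability of `ρ|F_v` (2-dimensional crystalline over
  `F_v = ℚ_p`, two distinct weights)**, the `ℓ = p` input of Barnet-Lamb–Gee–Geraghty–Taylor Thm. C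
  (`PatchingLocalComponentBarrier`).  In print for Hodge–Tate gap `≤ p` (Bartlett 2020; Gao–Liu 2014
  in the Fontaine–Laffaille range; ordinary: BLGGT Lemma 1.4.3 (1), PROVED in the tree as
  `blggt2014_lemma_1_4_3_1_holds`); OPEN beyond (first instance `V_{p+2,a_p}`, `0 < v(a_p) < 1`,
  item `stmt-Langlands-14523` of route `WachComponentCensus`, whose thesis `PD2Unram` contains this
  stub as its `f = 1` case).  This is the honest status of the crux: in print modulo bookkeeping for
  gaps `≤ p`, equivalent in difficulty to `PD2(ℚ_p)` in large weight beyond.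
* `stub_potentialAutomorphyOfTwist` — given the symmetrising datum, PD at the places above `p` and a
  NON-PARALLEL pair of labels: `I = Ind_E^K(ρ|_E ⊗ χ)` is Hodge–Tate regular (the two weight pairs
  above each place of `K` are concentric with different radii), crystalline and potentially
  diagonalisable above `p`, odd essentially self-dual with multiplier `θ`, residually irreducible
  over `K(ζ_p)`, `p ≥ 11 = 2(4+1)+1`; BLGGT Thm. C gives a totally real Galois `K'/K` with `I|Γ_{K'}`
  automorphic; `I ≅ I ⊗ η_{E/K}` and Arthur–Clozel (Ch. 3, Thm. 4.2 / Lemma 6.3) descend the cuspidal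
  `π` on `GL₄/K'` to a regular algebraic cuspidal `π₂` on `GL₂/EK'`, and HLTT Thm. A identifies
  `(ρ ⊗ χ)|Γ_{EK'}` with `r_ι(π₂)` (up to `c`): output `AutomorphicTwistOverCM F p ρ` (automorphy in
  the sense of `Qian2022.IsAutomorphic` over the CM field `E' = EK'`).
* `stub_parallelOfAutomorphicTwist` — an automorphic HT-algebraic twist of `ρ` over ANY CM field
  `E' ⊇ F` forces parallel gaps: A'Campo–Hevesi–Thorne–Whitmore 2026 Thm. 1.2.1 (labelled weights of
  `r_ι(π₂)` from the infinity type), Clozel's purity lemma (tree fact `Clozel1990_regularAlgebraic`,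
  clause (iii)) at `σ` and `conj ∘ σ`, and the observation that `ι⁻¹ ∘ conj ∘ ι` moves the label over
  `v` to a label over `v̄` (it acts by `−1` on `√−D`), with invariance of labelled weights under finite
  restriction (Patrikis §2.7.1) and their shift under an HT-algebraic twist.

`TwistedInductionParallel_of` composes the four stubs BY NAME (kernel-checked, no `sorry`):
contraposition; a non-parallel pair of labels is extracted from `¬ Parallel` by pure logic
(`stub_nonParallelPairOfNotParallel`, proved); PD is instantiated place by place (the second place above `p`
comes from the split hypothesis); the datum of stub 1 and the automorphy of stub 3 feed stub 4.

Disproof used: none exists for this crux (`ledger crux ls stmt-Langlands-17000`: `Lines/birth.*`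
only, 2026-08-17); negatives index of the summit has no entry of the shape of these stubs.
Sources: BarnetlambEtAl2014 (Thm. C, §1.4, Lemma 1.4.3), Bartlett2020, GaoLiu2014, GeeKisin2014,
ArthurClozelAMS120 (Ch. 3 Thm. 4.2, Lemma 6.3), HarrisLanTaylorThorneRMS2016 (Thm. A),
arXiv:2607.11763 (Thm. 1.2.1), Clozel1990 (Lemme 4.9), Patrikis2019 (§2.7.1), Calegari2010,
HarrisSoudryTaylor1993 (central character through the norm: the automorphic shadow of stub 1).
-/

noncomputable section

open scoped NumberField
open NumberField IsDedekindDomain Field Filter ValuativeRel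
open Literature.NumberTheory.GaloisRepresentations Literature.NumberTheory.PAdicHodge
open Literature.NumberTheory.Automorphic

-- `Summit.Langlands.Langlands.…` repeats a namespace component by design (D-0017 nested layout).
set_option linter.dupNamespace false

namespace Summit.Langlands.Langlands.Cruxes.TwistedInductionParallel.SymmetrisePdSplit

/-! ## 0. The hypothesis packages

LANDED (p165853, `Theorems/NonParallelVoidTwistedInductionParallelSymmetriseDefs.lean`, imported above):
`HasTwoWeights`, `GoodRegime`, `SameParity`, `Parallel`, `NonParallelPair`, `PDAbove`, `IsAlgebraicAbove`,
`SymmetrisingTwistDatum`, `AutomorphicTwistOverCM` (explicit parameters `F p ρ`; verbatim the registered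
sub-formulas), together with the proved glue stub `stub_nonParallelPairOfNotParallel`. -/

/-! ## 0'. Skeleton v4 additions (lead 0, cycle 1): waypoint 2' and the named-facts stub

`InducedTwistAutomorphic` — the LITERAL output of `BLGGT2014_thmC_potentialAutomorphy` (landed named fact,
`Literature/NumberTheory/Automorphic/BLGGT2014PotentialAutomorphy.lean`) for the induced twist
`I = Ind_E^K(ρ|_E ⊗ χ)` of a symmetrising datum: it sits BETWEEN stub 3 (potential automorphy of `I` over a
totally real `K'/K`) and the new stub 3' (Arthur–Clozel descent + HLTT + Chebotarev/Brauer–Nesbitt matching: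
`I|K'` automorphic ⇒ `ρ|E' ⊗ χ|E'` automorphic over the CM field `E' = EK'`, i.e. `AutomorphicTwistOverCM`).
Waypoint 2 (`AutomorphicTwistOverCM`) is KEPT for stub 4 (wave-1 stub-4 census §4: the HT finish is cheaper
than the archimedean one and its schemata are needed by stub 3 anyway).  The v4 vocabulary
`IsLocallyAlgebraicAbove`, `SymmetrisingTwistDatumLA`, `IsHodgeTateAlgebraicAbove`, `AutomorphicTwistOverCMHT`
(waypoint 2 re-typed for what stub 4 consumes), `InducedTwistAutomorphic` is LANDED in the imported Defs file
(p168558, skeleton v5). -/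

/-! ## 0''. Named facts of stub 4 — LANDED: `AHTW2026.labelledHodgeTateWeights_eq` (p168501),
`LabelledWeightsRestrictSchema`, `LabelledWeightsTwistSchema` (p168511), imported above. -/

/-! ## 1. The stubs (v4: 1, 2-small, 2-large, 3, 3', 4, named facts) -/

/-- **STUB 1 — symmetrising twist after a real quadratic base change (size M–L; class field theory;
NEW relative to the route header).**  For `F` imaginary quadratic, `ρ : Γ_F → GL₂(ℚ̄_p)` with two
distinct labelled weights at every label, in the good regime (split `p`, crystalline, `ρ̄|F(ζ_p)`
absolutely irreducible) and with gaps of the same parity, a `SymmetrisingTwistDatum F p ρ` exists.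
Paper proof: `det ρ = ε^{-s'}|_F · φ₀² · δ` with `φ₀` algebraic of type `((s−s')/2, 0)` unramified
at `p` (exists: finite unit group; this is where the PARITY hypothesis enters) and `δ` of finite
order; the class of `δ` in `X_F/(res X_ℚ + 2X_F) ≅ Hom(G_F^ab[2] ∩ ker N, ±1)` may be NON-ZERO over
`F` (explicit local obstruction at a split `ℓ ≡ 3 (4)`), but over `E = F(√d)`, `d > 0` with
`[E_w : F_v]` even at the finitely many `v` where `(det ρ)_v(−1) = −1` (and `p` split in `ℚ(√d)`,
`ℚ(√d)` disjoint from the field cut out by `ρ̄` over `F(ζ_p)`), `G_E^ab[2]` is generated by local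
`−1`'s (units + Grunwald–Wang for squares, `E` totally imaginary) on which `det ρ ∘ N_{E/F}` is
trivial, so `det ρ|_E = θ₁|_E · χ₁²`; a mixed-signature quadratic character of `K = ℚ(√d)` whose
restriction to `E` is a square (Hasse norm theorem for `E(i)/E`) corrects the signature of `θ`;
a finite-order factor of `χ` ramified at one auxiliary split prime keeps `Ind(ρ̄|_E ⊗ χ̄)|K(ζ_p)`
absolutely irreducible (Mackey: irreducible iff `ρ̄|_{E(ζ_p)}` irreducible and not
`c`-conjugate-self-twisted by `χ̄^{c-1}`).  Why it might fail: only through typing (pinned-datum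
crystallinity of Hecke-character avatars; `IsOdd` of a rank-one framed representation), or if
`G_E^ab[2]` had exotic 2-torsion beyond local signs for the `E` allowed here (it does not for `E` CM).
Cheapest falsifier: PARI census over `F = ℚ(√−D)`, `D ≤ 50`, of finite-order `δ` against all
`d ≤ 200`.  v4 (wave-1 stub-1 verdict `stub-misstated`): leading hypothesis `FontaineDatumExists` (clause (F12) reads
`det ρ|I_v = ε^{-(a+b)}` at the split prime), conclusion the re-typed `SymmetrisingTwistDatumLA`; corrected paper proof =
Taylor's square-root / real-quadratic device (Doc. Math. 2006, p. 777) over the tree's global CFT (worker census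
§2–§4, A-1…A-6). [cite: BarnetlambEtAl2014, §2.1] [cite: HarrisSoudryTaylor1993, Introduction (central character through the norm)] -/
theorem stub_symmetrisingTwist :
    Literature.NumberTheory.PAdicHodge.FontaineDatumExists →
    ∀ (F : Type) [Field F] [NumberField F] [Algebra.IsQuadraticExtension ℚ F],
    NumberField.IsTotallyComplex F → ∀ (p : ℕ) [Fact p.Prime]
    (ρ : FramedGaloisRep F (PadicAlgCl p) 2),
    HasTwoWeights F p ρ → GoodRegime F p ρ → SameParity F p ρ →
    SymmetrisingTwistDatumLA F p ρ := by
  sorry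

/-- **STUB 1-C2 (v9) — a quadratic extension of local fields makes every finite-order character
2-divisible** (size M–L; local class field theory).  For `M/L` quadratic non-archimedean local fields of
characteristic `0` and `ν : Γ_L → ℚ/ℤ` locally constant additive, `ν ∘ res_{L,M}` is twice a locally constant
character of `Γ_M`.  In print: the obstruction is the image of the Bockstein class under
`Res : H²(L, ℤ/2) = Br(L)[2] → Br(M)`, which is multiplication by `[M : L] = 2` on invariants
(Serre, Local Fields XIII §3 Prop. 7 and Cor. 1); in the tree: local Artin maps with norm functoriality
(`exists_isLocalArtinMap_holds`, `canonicalArtin_map`), `N_{M/L}(-1) = 1`, and the 2-torsion `{±1}` of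
`M̂ˣ`. [cite: SerreLocalFields1979, Ch. XIII §3, Prop. 7 and Cor. 1; §4 Prop. 10] -/
theorem stub_twoDivisible_restrict_quadratic :
    ∀ (L M : Type) [Field L] [ValuativeRel L] [TopologicalSpace L] [IsNonarchimedeanLocalField L]
      [CharZero L] [Field M] [ValuativeRel M] [TopologicalSpace M] [IsNonarchimedeanLocalField M]
      [CharZero M] [Algebra L M], Module.finrank L M = 2 →
    ∀ (ν : absoluteGaloisGroup L → AddCircle (1 : ℚ)),
      IsLocallyConstant ν → (∀ σ τ, ν (σ * τ) = ν σ + ν τ) →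
      ∃ μ : absoluteGaloisGroup M → AddCircle (1 : ℚ),
        IsLocallyConstant μ ∧ (∀ σ τ, μ (σ * τ) = μ σ + μ τ) ∧
        ∀ σ, 2 • μ σ = ν (absGaloisRestrict L M σ) := by
  sorry

/-- **STUB 1-G (v9) — quadratic clean-up above `p`** (size M).  For `p` odd and a locally constant
additive `μ : Γ_E → ℚ/ℤ` which is 2-torsion on the inertia group at every place `u ∣ p`, there is a global
QUADRATIC locally constant character `q` with `μ + q` trivial on those inertia groups.  Proof: on
`I_u = absInertia (E_u)` a 2-torsion character kills wild inertia and factors through the procyclic tame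
quotient, so it is `0` or the Kummer character of a local uniformiser; take `q` = Kummer character of a
`γ ∈ 𝓞_E` with `ord_u γ` odd exactly at the `u ∣ p` where `μ|I_u ≠ 0` and `γ` a `u`-unit at the others
(CRT; `u ∤ 2`). [cite: SerreLocalFields1979, Ch. IV §2 (tame inertia)] -/
theorem stub_quadraticFixAboveP :
    ∀ (E : Type) [Field E] [NumberField E] (p : ℕ) [Fact p.Prime], p ≠ 2 →
    ∀ (μ : absoluteGaloisGroup E → AddCircle (1 : ℚ)),
      IsLocallyConstant μ → (∀ σ τ, μ (σ * τ) = μ σ + μ τ) →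
      (∀ (u : HeightOneSpectrum (𝓞 E)), ((p : ℕ) : 𝓞 E) ∈ u.asIdeal →
        ∀ σ ∈ absInertia (u.adicCompletion E),
          2 • μ (absGaloisRestrict E (u.adicCompletion E) σ) = 0) →
      ∃ q : absoluteGaloisGroup E → AddCircle (1 : ℚ),
        IsLocallyConstant q ∧ (∀ σ τ, q (σ * τ) = q σ + q τ) ∧ (∀ σ, 2 • q σ = 0) ∧
        ∀ (u : HeightOneSpectrum (𝓞 E)), ((p : ℕ) : 𝓞 E) ∈ u.asIdeal →
          ∀ σ ∈ absInertia (u.adicCompletion E),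
            μ (absGaloisRestrict E (u.adicCompletion E) σ) +
              q (absGaloisRestrict E (u.adicCompletion E) σ) = 0 := by
  sorry

/-- **STUB 1-D (v9) — residual absolute irreducibility of the induced twist over `K(ζ_p)`, generically**
(size L).  Given `ρ̄|Γ_{F(ζ_p)}` absolutely irreducible, there is a finite set `V` of places of `F` (avoiding
any given finite `S`) such that for every `E ⊇ F` in which `V` splits completely
(`exists_finset_forall_splitPrimes_residual_hypotheses` (c): `ρ̄(Γ_{E(ζ_p)}) = ρ̄(Γ_{F(ζ_p)})`), every
totally real `K` with `[E : K] = 2`, `E` totally complex, `E ⊄ K(ζ_p)`, and every `χ`, some quadratic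
(Kummer) `q'` trivial on the inertia groups above `p` makes
`Ind_E^K(ρ|_E ⊗ χq')|_{K(ζ_p)}` residually absolutely irreducible: Mackey
(`isResiduallyAbsIrreducible_restrictField_induce_of_finrank_eq_two` with `L = K(ζ_p)`, `M = E(ζ_p)`,
`hM` = `mem_range_absGaloisRestrict_cyclotomicField_iff`), `hirr` by twist-invariance, and `hreg` by an
auxiliary prime `u₀` of `E` split over `K` where `ρ`, `χ` are unramified and `q'/q'^g` is ramified
quadratic (charpolys `(X-1)²` vs `(X+1)²` on an inertia element, distinct mod `𝔪` for `p` odd).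
[cite: ACCGHLNSTT2023, §6.5.12] [cite: BarnetlambEtAl2014, §2.1] -/
theorem stub_residualIrreducibility_generic :
    ∀ (F : Type) [Field F] [NumberField F] (p : ℕ) [Fact p.Prime], p ≠ 2 →
    ∀ (ρ : FramedGaloisRep F (PadicAlgCl p) 2),
      (∀ᶠ v : HeightOneSpectrum (𝓞 F) in Filter.cofinite, ρ.IsUnramifiedAt v) →
      FramedGaloisRep.IsResiduallyAbsIrreducible (ρ.restrictField (CyclotomicField p F)) →
      ∀ (S : Set (HeightOneSpectrum (𝓞 F))), S.Finite →
      ∃ V : Finset (HeightOneSpectrum (𝓞 F)),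
        (∀ q ∈ V, q ∉ S) ∧
        ∀ (K E : Type) [Field K] [NumberField K] [Field E] [NumberField E]
          [Algebra F E] [Algebra K E] (hd : Module.finrank K E = 2),
          NumberField.IsTotallyReal K → NumberField.IsTotallyComplex E →
          (∀ q ∈ V, q ∈ splitPrimes F E) →
          ¬ ((absGaloisRestrict K (CyclotomicField p K)).range ≤ (absGaloisRestrict K E).range) →
          ∀ (χ : absoluteGaloisGroup E →ₜ* (PadicAlgCl p)ˣ),
            ∃ q' : absoluteGaloisGroup E →ₜ* (PadicAlgCl p)ˣ,
              (∀ σ, q' σ = 1 ∨ q' σ = -1) ∧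
              (∀ (u : HeightOneSpectrum (𝓞 E)), ((p : ℕ) : 𝓞 E) ∈ u.asIdeal →
                ∀ σ ∈ absInertia (u.adicCompletion E),
                  q' (absGaloisRestrict E (u.adicCompletion E) σ) = 1) ∧
              FramedGaloisRep.IsResiduallyAbsIrreducible
                ((FramedGaloisRep.induce K hd (FramedRep.twist (ρ.restrictField E) (χ * q'))).restrictField
                  (CyclotomicField p K)) := by
  sorry


/-- **STUB 1-W5 (v10) — local arithmetic of the quadratic extension `E = F(√θ)`** (size M–L;
elementary).  (a) at a finite place `v` of `F` where `θ` is not a square, every place `w ∣ v` of `E` has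
local degree `[E_w : F_v] = 2` (one place above `v`, `e f = 2`; `SemiLocal.finrank_place_eq_card_stabilizer`,
`QuadraticExtension.ncard_finitePlacesOver_eq_one_iff_not_isSquare`); (b) away from `2`, `θ` a square in `F_v`
⇒ `v` splits completely (`v ∈ splitPrimes F E`); (c1)/(c1') odd valuation ⇒ not a square (in particular
`θ = d` exactly divisible by `ℓ` at an unramified `v ∣ ℓ`); (c2) a unit quadratic non-residue at a degree-one
odd place is not a square (residue field `𝔽_ℓ`); (c3) `d ≡ 5 (mod 8)` is not a square at a degree-one dyadic
place (else `y = (1+√d)/2` is an integral root of `X² - X - (d-1)/4 ≡ X² + X + 1 (mod 2)` in a residue field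
`𝔽₂`); (c4) Hensel: `d ≡ 1 (mod ℓ)`, `ℓ` odd, is a square in `F_v` for `v ∣ ℓ`.  These are the certificates by
which the lead chooses `d` (CRT) so that the bad places of the finite-order error are non-split and the
genericity set `V` splits. [cite: SerreLocalFields1979, Ch. XIV §3–4 (squares in local fields); Ch. I §7–8] [cite: NeukirchANT1999, Ch. II (4.6) Hensel, Ch. I (8.3)] -/
theorem stub_quadraticExtensionLocal :
    ∀ (F E : Type) [Field F] [NumberField F] [Field E] [NumberField E] [Algebra F E]
      (θ : F) (α : E), α ^ 2 = algebraMap F E θ → (∀ r : F, algebraMap F E r ≠ α) →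
      Module.finrank F E = 2 →
    (∀ (v : HeightOneSpectrum (𝓞 F)), ¬ IsSquare (algebraMap F (v.adicCompletion F) θ) →
      ∀ (w : HeightOneSpectrum (𝓞 E)) [w.asIdeal.LiesOver v.asIdeal],
        letI := (Literature.NumberTheory.Automorphic.adicCompletionOfLiesOver F E v w).toAlgebra
        Module.finrank (v.adicCompletion F) (w.adicCompletion E) = 2) ∧
    (∀ (v : HeightOneSpectrum (𝓞 F)), IsSquare (algebraMap F (v.adicCompletion F) θ) →
      ((2 : ℕ) : 𝓞 F) ∉ v.asIdeal → v ∈ splitPrimes F E) ∧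
    (∀ (v : HeightOneSpectrum (𝓞 F)), θ ≠ 0 → ¬ (2 : ℤ) ∣ WithZero.log (v.valuation F θ) →
      ¬ IsSquare (algebraMap F (v.adicCompletion F) θ)) ∧
    (∀ (v : HeightOneSpectrum (𝓞 F)) (ℓ : ℕ), ℓ.Prime → ((ℓ : ℕ) : 𝓞 F) ∈ v.asIdeal →
      v.asIdeal.ramificationIdx ℤ = 1 →
      ∀ d : ℤ, θ = (d : F) → (ℓ : ℤ) ∣ d → ¬ ((ℓ : ℤ) ^ 2 ∣ d) →
      ¬ IsSquare (algebraMap F (v.adicCompletion F) θ)) ∧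
    (∀ (v : HeightOneSpectrum (𝓞 F)) (ℓ : ℕ), ℓ.Prime → ℓ ≠ 2 → Ideal.absNorm v.asIdeal = ℓ →
      ∀ d : ℤ, θ = (d : F) → ¬ ((ℓ : ℤ) ∣ d) → ¬ IsSquare ((d : ZMod ℓ)) →
      ¬ IsSquare (algebraMap F (v.adicCompletion F) θ)) ∧
    (∀ (v : HeightOneSpectrum (𝓞 F)), Ideal.absNorm v.asIdeal = 2 →
      ∀ d : ℤ, θ = (d : F) → d % 8 = 5 → ¬ IsSquare (algebraMap F (v.adicCompletion F) θ)) ∧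
    (∀ (v : HeightOneSpectrum (𝓞 F)) (ℓ : ℕ), ℓ.Prime → ℓ ≠ 2 → ((ℓ : ℕ) : 𝓞 F) ∈ v.asIdeal →
      ∀ d : ℤ, θ = (d : F) → (ℓ : ℤ) ∣ d - 1 → IsSquare (algebraMap F (v.adicCompletion F) θ)) := by
  sorry


/-- **STUB 2-large — potential diagonalisability at a split prime, gap ≥ p (THE OPEN LOCAL INPUT).**
The registered v1 signature with the extra conjunct `(p : ℤ) ≤ b - a`: PD of 2-dimensional crystalline
representations of `Γ_{ℚ_p}` of Hodge–Tate gap `≥ p` — OPEN (arXiv:2604.17466 §1 p. 3; first open instance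
`V_{p+2,a_p}`, `0 < v(a_p) < 1`, item stmt-Langlands-14523; umbrella stmt-Langlands-14643 `PD2Unram`, of which
this is the `f = 1` slice; Bartlett 2020 covers gap `= p` only under "strongly cyclotomic-free").  Blocked on
stmt-Langlands-14643. [cite: BarnetlambEtAl2014, §1.4 (Introduction: "we know of no counterexample")] -/
theorem stub_pdAtSplitPrime_large :
    ∀ (F : Type) [Field F] [NumberField F] [Algebra.IsQuadraticExtension ℚ F] (p : ℕ) [Fact p.Prime],
    11 ≤ p → ∀ (ρ : FramedGaloisRep F (PadicAlgCl p) 2)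
    (v : IsDedekindDomain.HeightOneSpectrum (NumberField.RingOfIntegers F))
    (hv : ((p : ℕ) : NumberField.RingOfIntegers F) ∈ v.asIdeal),
    (∃ w : IsDedekindDomain.HeightOneSpectrum (NumberField.RingOfIntegers F), w ≠ v ∧
      ((p : ℕ) : NumberField.RingOfIntegers F) ∈ w.asIdeal) →
    (Literature.NumberTheory.PAdicHodge.fontainePstAdicCompletion v p hv).IsCrystallineFramed (ρ.toLocal v) →
    (letI := (Literature.NumberTheory.PAdicHodge.fontainePstAdicCompletion v p hv).algebra
     ∀ τ : v.adicCompletion F →ₐ[ℚ_[p]] PadicAlgCl p, ∃ a b : ℤ, a < b ∧ (p : ℤ) ≤ b - a ∧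
      ρ.labelledHodgeTateWeightsAt v
        (Literature.NumberTheory.PAdicHodge.fontainePstAdicCompletion v p hv).algebra
        (Literature.NumberTheory.PAdicHodge.fontainePstAdicCompletion v p hv).𝔅 τ.toRingHom = {a, b}) →
    ∀ 𝔈 : PstCrystallineExtensionData (Literature.NumberTheory.PAdicHodge.fontainePstAdicCompletion v p hv),
    letI := (Literature.NumberTheory.PAdicHodge.fontainePstAdicCompletion v p hv).algebra
    IsPotentiallyDiagonalizable 𝔈.𝔅 (ρ.toLocal v) := by
  sorry

/-- **STUB F — the named facts in print that the other stubs consume** (precedent: `stub_namedFacts` of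
crux SerreGSp4Surjective, line singer-type-evaporation): BLGGT 2014 Theorem C (landed,
`BLGGT2014_thmC_potentialAutomorphy`), Gao–Liu 2014 (landed, `gaoLiu2014_mainTheorem`), Fontaine's datum
(`FontaineDatumExists`, the summit's pinned `p`-adic Hodge datum), HLTT Thm. A (`theoremA_existence`), and
stub 4's three inputs typed by its wave-1 worker (to be vendored under Literature: AHTW Thm. 1.2.1 EXACT
weights `AHTW2026.labelledHodgeTateWeights_eq`, and the two pinned-data labelled-weights schemata
`LabelledWeightsRestrictSchema`, `LabelledWeightsTwistSchema` — Fontaine Exp. III §1.5, Brinon–Conrad 6.3.8,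
Patrikis §2.7.1).  The facts
the wave-1 workers are vendoring (HLTT Thm. A existence is already `theoremA_existence`; AHTW Thm. 1.2.1 exact
weights; the labelled-weights restriction/twist schemata; the crystalline/PD local schemata; Arthur–Clozel 4.2 (b)
in the needed shape) join this conjunction at the next reshape; v6 adds the six pinned-data schemata consumed by stub 3
(`IsDeRhamFramedInduceSchema`, `LabelledWeightsInduceSchema` — Patrikis 2019 Lemma 7.2.1, p169548;
`PDRestrictSchema`, `PDTwistSchema`, `PDInduceSchema` — BLGGT §1.4, p169553; `LabelledWeightsDetSchema` —
Fontaine Exp. III Prop. 1.5.2, p169647).  Closable only by DISCHARGING the facts.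
[cite: BarnetlambEtAl2014, Theorem C] [cite: GaoLiu2014, Thm. 3.0.3] [cite: Patrikis2019, Lemma 7.2.1] -/
theorem stub_namedFacts :
    BLGGT2014_thmC_potentialAutomorphy_avoid ∧ gaoLiu2014_mainTheorem.{0} ∧
      Literature.NumberTheory.PAdicHodge.FontaineDatumExists ∧ HarrisLanTaylorThorne2016.theoremA_existence ∧
      AHTW2026.labelledHodgeTateWeights_eq
        (fun (K : Type) [Field K] [NumberField K] (p : ℕ) [Fact p.Prime]
          (v : HeightOneSpectrum (𝓞 K)) (hv : ((p : ℕ) : 𝓞 K) ∈ v.asIdeal) =>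
            fontainePstAdicCompletion v p hv) ∧
      LabelledWeightsRestrictSchema ∧ LabelledWeightsTwistSchema ∧
      IsDeRhamFramedInduceSchema ∧ LabelledWeightsInduceSchema ∧ PDRestrictSchema ∧ PDTwistSchema ∧
      PDInduceSchema ∧ LabelledWeightsDetSchema ∧
      Literature.NumberTheory.Automorphic.ArthurClozel1989_automorphicInduction_of_selfTwist ∧
      Henniart2012_infinityType_of_automorphicInduction ∧
      (∀ (E : Type) [Field E] [NumberField E] (N : ℕ) (hcpt : isCompact_glFiniteIntegralLevel N E)
        (P : CuspidalAutomorphicRepData N E hcpt), P.1.exists_hasInfinityType) := by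
  sorry

/-! ## 2. The stub statements as named `Prop`s (literally the types of the stubs) -/

namespace _Goal

/-- The statement of `stub_symmetrisingTwist`, as a named `Prop` (literally its type). [folklore] -/
def stub_symmetrisingTwist : Prop :=
  type_of% @Summit.Langlands.Langlands.Cruxes.TwistedInductionParallel.SymmetrisePdSplit.stub_symmetrisingTwist

/-- The statement of `stub_pdAtSplitPrime_small` (literally its type). [folklore] -/
def stub_pdAtSplitPrime_small : Prop :=
  type_of% @Summit.Langlands.Langlands.Cruxes.TwistedInductionParallel.SymmetrisePdSplit.stub_pdAtSplitPrime_small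

/-- The statement of `stub_pdAtSplitPrime_large` (literally its type). [folklore] -/
def stub_pdAtSplitPrime_large : Prop :=
  type_of% @Summit.Langlands.Langlands.Cruxes.TwistedInductionParallel.SymmetrisePdSplit.stub_pdAtSplitPrime_large

/-- The statement of `stub_potentialAutomorphyOfInducedTwistIrr` (literally its type). [folklore] -/
def stub_potentialAutomorphyOfInducedTwistIrr : Prop :=
  type_of% @Summit.Langlands.Langlands.Cruxes.TwistedInductionParallel.SymmetrisePdSplit.stub_potentialAutomorphyOfInducedTwistIrr

/-- The statement of `stub_automorphicTwistOfInducedAutomorphy` (literally its type). [folklore] -/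
def stub_automorphicTwistOfInducedAutomorphy : Prop :=
  type_of% @Summit.Langlands.Langlands.Cruxes.TwistedInductionParallel.SymmetrisePdSplit.stub_automorphicTwistOfInducedAutomorphy

/-- The statement of `stub_parallelOfAutomorphicTwist` (literally its type). [folklore] -/
def stub_parallelOfAutomorphicTwist : Prop :=
  type_of% @Summit.Langlands.Langlands.Cruxes.TwistedInductionParallel.SymmetrisePdSplit.stub_parallelOfAutomorphicTwist

/-- The statement of `stub_namedFacts` (literally its type). [folklore] -/
def stub_namedFacts : Prop :=
  type_of% @Summit.Langlands.Langlands.Cruxes.TwistedInductionParallel.SymmetrisePdSplit.stub_namedFacts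

/-- The statement of `stub_twoDivisible_of_locally` (literally its type). [folklore] -/
def stub_twoDivisible_of_locally : Prop :=
  type_of% @Summit.Langlands.Langlands.Cruxes.TwistedInductionParallel.SymmetrisePdSplit.stub_twoDivisible_of_locally

/-- The statement of `stub_twoDivisible_restrict_quadratic` (literally its type). [folklore] -/
def stub_twoDivisible_restrict_quadratic : Prop :=
  type_of% @Summit.Langlands.Langlands.Cruxes.TwistedInductionParallel.SymmetrisePdSplit.stub_twoDivisible_restrict_quadratic

/-- The statement of `stub_quadraticFixAboveP` (literally its type). [folklore] -/
def stub_quadraticFixAboveP : Prop :=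
  type_of% @Summit.Langlands.Langlands.Cruxes.TwistedInductionParallel.SymmetrisePdSplit.stub_quadraticFixAboveP

/-- The statement of `stub_residualIrreducibility_generic` (literally its type). [folklore] -/
def stub_residualIrreducibility_generic : Prop :=
  type_of% @Summit.Langlands.Langlands.Cruxes.TwistedInductionParallel.SymmetrisePdSplit.stub_residualIrreducibility_generic

/-- The statement of `stub_quadraticExtensionLocal` (literally its type). [folklore] -/
def stub_quadraticExtensionLocal : Prop :=
  type_of% @Summit.Langlands.Langlands.Cruxes.TwistedInductionParallel.SymmetrisePdSplit.stub_quadraticExtensionLocal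

end _Goal

/-! ## 3. Pure-logic glue — LANDED

`stub_nonParallelPairOfNotParallel` (¬Parallel ∧ HasTwoWeights ⇒ NonParallelPair) is imported from the
Defs file (p165853).  Also LANDED for stub 3: `FramedGaloisRep.induce_isSymplecticWithMultiplier_of_det_eq`
(`Literature/NumberTheory/GaloisRepresentations/InducedSymplectic.lean`, p166680: det ρ = θ|Γ_F ⇒ Ind ρ
symplectic with multiplier θ — the odd essential self-duality of `Ind_E^K(ρ|_E ⊗ χ)` from clause (b) of the
symmetrising datum) and `FramedGaloisRep.induce_twist_eq_conj` (`…/InducedSelfTwist.lean`, p166834: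
the self-twist `I ⊗ η ≅ I`). -/

/-! ## 4. The composition (kernel-checked, no `sorry`) -/

section Glue

variable {F : Type} [Field F] [NumberField F] [Algebra.IsQuadraticExtension ℚ F] {p : ℕ} [Fact p.Prime]
  {ρ : FramedGaloisRep F (PadicAlgCl p) 2}

/-- **`PDAbove` from the two PD stubs**, by case split on the gap at the UNIQUE label of a split place
(`subsingleton_algHom_adicCompletion_of_split`, landed p167417: `p` split in the quadratic `F` ⇒ one
`ℚ_p`-algebra label `F_v → ℚ̄_p` for the canonical = pinned `ℚ_p`-structure). [folklore] -/
theorem pdAbove_of_stubs (hsmall : _Goal.stub_pdAtSplitPrime_small) (hlarge : _Goal.stub_pdAtSplitPrime_large)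
    (hfacts : _Goal.stub_namedFacts) (hHT : HasTwoWeights F p ρ) (hG : GoodRegime F p ρ) : PDAbove F p ρ := by
  intro v hv 𝔈
  obtain ⟨v₀, w₀, hne, hv₀, hw₀⟩ := hG.2.1
  have hsplit : ∃ w : IsDedekindDomain.HeightOneSpectrum (NumberField.RingOfIntegers F), w ≠ v ∧
      ((p : ℕ) : NumberField.RingOfIntegers F) ∈ w.asIdeal := by
    by_cases h : v₀ = v
    · exact ⟨w₀, fun hw => hne (h.trans hw.symm), hw₀⟩
    · exact ⟨v₀, h, hv₀⟩
  obtain ⟨w, hwv, hw⟩ := hsplit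
  -- one label at the split place `v`
  haveI : Subsingleton (letI := (fontainePstAdicCompletion v p hv).algebra
      v.adicCompletion F →ₐ[ℚ_[p]] PadicAlgCl p) := by
    rw [fontainePstAdicCompletion_algebra_eq_adicCompletionPadicAlgebra v p hv]
    exact LocalField.subsingleton_algHom_adicCompletion_of_split p v w (Ne.symm hwv) hv hw _
  letI := (fontainePstAdicCompletion v p hv).algebra
  by_cases hcase : ∀ τ : v.adicCompletion F →ₐ[ℚ_[p]] PadicAlgCl p, ∃ a b : ℤ, a < b ∧ b - a + 1 ≤ p ∧
      ρ.labelledHodgeTateWeightsAt v (fontainePstAdicCompletion v p hv).algebra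
        (fontainePstAdicCompletion v p hv).𝔅 τ.toRingHom = {a, b}
  · exact hsmall hfacts.2.1 F p hG.1 ρ v hv ⟨w, hwv, hw⟩ (hG.2.2.1 v hv) hcase 𝔈
  · refine hlarge F p hG.1 ρ v hv ⟨w, hwv, hw⟩ (hG.2.2.1 v hv) (fun τ => ?_) 𝔈
    obtain ⟨τ₁, hτ₁⟩ := not_forall.1 hcase
    obtain ⟨a, b, hab, hw'⟩ := (hHT v hv).2 τ
    refine ⟨a, b, hab, ?_, hw'⟩
    by_contra hlt
    refine hτ₁ ⟨a, b, hab, by omega, ?_⟩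
    rw [Subsingleton.elim τ₁ τ]
    exact hw'

end Glue

/-- **Composition (v8): the three remaining stubs (1, 2-large, named facts) and the four LANDED stubs
(2-small p168441, 3 p170502, 3' p170596, 4 p169228, imported) give the crux BY NAME.**  Contraposition: if the gaps were not
all equal, `stub_nonParallelPairOfNotParallel` (landed glue) gives a non-parallel pair; `pdAbove_of_stubs`
gives PD above `p` from stubs 2-small (Gao–Liu, in print) / 2-large (open) at the unique label of each split
place; stub 1 gives the symmetrising datum; stub 3 the potential automorphy of the induced twist (BLGGT Thm C
from `stub_namedFacts`); stub 3' the descent to an automorphic twist over a CM field; stub 4 forces `Parallel`.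
[folklore] -/
theorem TwistedInductionParallel_of (h₁ : _Goal.stub_symmetrisingTwist)
    (h₂' : _Goal.stub_pdAtSplitPrime_large) (hF : _Goal.stub_namedFacts) :
    Summit.Langlands.Langlands.Theses.NonParallelVoid.TwistedInductionParallel := by
  intro F _ _ _ hFc p _ ρ hirr hunr hHT hG hE
  by_contra hC
  have hHT' : HasTwoWeights F p ρ := hHT
  have hG' : GoodRegime F p ρ := hG
  have hE' : SameParity F p ρ := hE
  have hpair : NonParallelPair F p ρ := stub_nonParallelPairOfNotParallel F p ρ hHT' hC
  have hPD : PDAbove F p ρ := pdAbove_of_stubs stub_pdAtSplitPrime_small h₂' hF hHT' hG'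
  obtain ⟨hBLGGT, -, hFD, hHLTT, hAHTW, hR, hT, hI1, hI2, hP1, hP2, hP3, hD, hAC, hHen, hex⟩ := hF
  have hdatum : SymmetrisingTwistDatumLA F p ρ := h₁ hFD F hFc p ρ hHT' hG' hE'
  have hind : InducedTwistAutomorphicIrr F p ρ :=
    stub_potentialAutomorphyOfInducedTwistIrr hBLGGT hFD hI1 hI2 hP1 hP2 hP3 hR hT hD F hFc p ρ hirr
      hunr hHT' hG' hpair hPD hdatum
  have haut : AutomorphicTwistOverCMHT F p ρ :=
    stub_automorphicTwistOfInducedAutomorphy hHLTT hAC hHen hex F hFc p ρ hirr hunr hG' hind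
  exact hC (stub_parallelOfAutomorphicTwist hHLTT hAHTW hR hT F hFc p ρ hHT' haut)

/-- By-name sanity check (an `example`, not a declaration of the file): the three remaining stubs feed
the composition as they stand (the four landed stubs are used by name inside it). -/
example : Summit.Langlands.Langlands.Theses.NonParallelVoid.TwistedInductionParallel :=
  TwistedInductionParallel_of stub_symmetrisingTwist stub_pdAtSplitPrime_large stub_namedFacts

end Summit.Langlands.Langlands.Cruxes.TwistedInductionParallel.SymmetrisePdSplit
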